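import Literature.MeasureTheory.Group.InvariantQuotientTransport      -- ★ `cosetCongr`, `subgroupCongrHomeomorph`, `map_cosetCongr_quotientMeasure` (naturality of `quotientMeasure` along `e : G ≃* G′`)
import Literature.MeasureTheory.Group.InvariantQuotientConjugacySum   -- ★ `descConj γ M _ F : G ⧸ M → E` (the orbital integrand)
import HarnessLib

/-!
# Quotient orbital integrals are invariant under the normaliser of the torus («realised Weyl reflections do not change `Φ_T(γ, f)`»)
(Shelstad (1979) §4; Harish-Chandra; Folland (1995) §2.6 Thm. 2.49; Deitmar–Echterhoff (2014) Thm. 1.5.3)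

Topic `MeasureTheory/Group`; namespace `Literature.MeasureTheory.Group`.  THEOREMS ONLY (no `def`, no instance, no notation, no axiom, no named fact, no `sorry`);
generic (any second countable locally compact group).  Cell `pub/hodgecm-mathlib`, crux H413 (`stmt-HodgeConjecture-24833`), F0∕P3c line LH3 (closer stub `stub_N9`, DIRECT
ROAD): the measure-theoretic half (β) of organ «(W-real)» = `chartOrbH_negXAt` (LH3-plan (g2) 2026-09-02T05:53:17Z; consumer ★ p849717 `archBzWeyl_stOrbFamH`'s one
hypothesis `hneg`), seat LH2-p04 (g3).  Count-neutral kit.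

THE MATHEMATICS.  `G` locally compact second countable, `T ≤ G` closed with an inversion-invariant Haar measure `t`, `ν` a Haar measure on `G` (right invariant too),
`ν ∕ t := quotientMeasure T t ν` the quotient measure on `G ⧸ T` (★ Deitmar–Echterhoff 1.5.3).  For `n ∈ N_G(T)` the conjugation `Ad(n) : G ≃* G` carries `T` to `T`
and `ν` to `ν` (unimodular), so by ★ naturality (`map_cosetCongr_quotientMeasure`) it carries `ν ∕ t` to `ν ∕ Ad(n)_* t`.  Hence, WHEN `Ad(n)_* t = t`:
* **`map_conj_smul_quotientMeasure_eq`** — the right translation `y T ↦ y n⁻¹ T = n⁻¹ · Ad(n)(y T)` preserves `ν ∕ t`;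
* **`integral_descConj_conj_eq`** — `∫_{G⧸T} F(y · n⁻¹ γ n · y⁻¹) d(ν∕t) = ∫_{G⧸T} F(y γ y⁻¹) d(ν∕t)` for every `γ` centralised by `T` and every `F : G → E` (no measurability
  needed: transport along a homeomorphism of `G ⧸ T`): the quotient orbital integral is invariant under the realised Weyl group `N_G(T)/T`.
And the hypothesis holds for free in the case that matters: **`map_eq_self_of_involutive`** — a continuous INVOLUTIVE automorphism `ψ` of a second countable locally
compact group preserves every Haar measure (`ψ_* t = c • t` by uniqueness, `ψ ∘ ψ = id` ⇒ `c² = 1`; the Mathlib inversion-invariance argument), so `Ad(n)_* t = t`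
whenever `n² ∈ Z_G(T)` — e.g. the reflection `x ↦ −x` of the split Cartan of `U(1,1)` realised by `antidiag(1,1)` (**`map_conj_eq_self_of_conj_conj_eq`**); `Ad(n)_* ν = ν`
for the two-sided `ν` is ★ `Literature.NumberTheory.Automorphic.map_mulAutConj_eq_self` (inlined here).
NOT HERE: the `H_∞` dress (`n_w`, `endoTorus S (negXAt w c) = n_w · endoTorus S c · n_w⁻¹`, `chartOrbH_negXAt`) — next file over ★ p849670 ∕ ★ p849730.
HONEST LABEL: HC_CM is proved only modulo the 7 printed citations (2 remaining: hLiu418 = `stmt-HodgeConjecture-24832`, h413 = `stmt-HodgeConjecture-24833`) until rung 0 closes;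
count-neutral.

## References
* [Shelstad1979] D. Shelstad, *Characters and inner forms of a quasi-split group over ℝ*, Compositio Math. 39 (1979), §4 pp. 22–23 (`Φ^T_f` is invariant under the
  realised Weyl group `Ω(G, T)`; the reflection in a real root).
* [Folland1995] G. B. Folland, *A Course in Abstract Harmonic Analysis* (1995), §2.2 (uniqueness of Haar measure; automorphisms), §2.6 Thm. 2.49, (2.52).
* [DeitmarEchterhoff2014] A. Deitmar, S. Echterhoff, *Principles of Harmonic Analysis*, 2nd ed. (2014), Thm. 1.5.3 (quotient integral formula, uniqueness).
-/

set_option autoImplicit false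

noncomputable section

open MeasureTheory MeasureTheory.Measure Set Topology Filter
open scoped ENNReal NNReal

namespace Literature.MeasureTheory.Group

/-! ## §1 Involutive automorphisms preserve Haar measure; `Ad(n)` preserves a two-sided Haar measure -/

section Involutive

variable {T : Type*} [Group T] [TopologicalSpace T] [IsTopologicalGroup T] [LocallyCompactSpace T] [SecondCountableTopology T]
  [MeasurableSpace T] [BorelSpace T]

/-- **A continuous INVOLUTIVE automorphism preserves every Haar measure**: `ψ_* t` is a Haar measure, hence `c • t`; `ψ ∘ ψ = id` gives `t = c² • t`, so `c = 1`
(the Mathlib argument for inversion on abelian groups, `IsHaarMeasure.isInvInvariant_of_regular`). [cite: Folland1995, §2.2] -/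
theorem map_eq_self_of_involutive (ψ : T ≃* T) (hψ : Continuous ψ) (hψs : Continuous ψ.symm) (hinv : ∀ x, ψ (ψ x) = x)
    (t : Measure T) [t.IsHaarMeasure] : Measure.map ψ t = t := by
  haveI : (Measure.map ψ t).IsHaarMeasure := ψ.isHaarMeasure_map t hψ hψs
  set c : ℝ≥0 := haarScalarFactor (Measure.map ψ t) t with hc
  have h1 : Measure.map ψ t = c • t := isMulLeftInvariant_eq_smul _ _
  have hψψ : (ψ : T → T) ∘ ψ = id := funext hinv
  have h2 : Measure.map ψ (Measure.map ψ t) = t := by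
    rw [Measure.map_map hψ.measurable hψ.measurable, hψψ, Measure.map_id]
  have h3 : t = (c * c) • t := by
    conv_lhs => rw [← h2, h1, Measure.map_smul, h1, smul_smul]
  -- evaluate on a positive compact
  obtain ⟨K⟩ := (inferInstance : Nonempty (TopologicalSpace.PositiveCompacts T))
  have hKpos : 0 < t K := measure_pos_of_nonempty_interior t K.interior_nonempty
  have hKfin : t K < ⊤ := K.isCompact.measure_lt_top
  have h4 : ((c * c : ℝ≥0) : ℝ≥0∞) * t K = 1 * t K := by
    have := congrArg (fun μ : Measure T => μ K) h3
    simp only [Measure.smul_apply, ENNReal.smul_def, smul_eq_mul] at this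
    rw [one_mul]; exact this.symm
  have h5 : ((c * c : ℝ≥0) : ℝ≥0∞) = 1 := (ENNReal.mul_left_inj hKpos.ne' hKfin.ne).mp h4
  have h6 : c * c = 1 := by exact_mod_cast h5
  have h7 : c = 1 := by
    have h6' : (c : ℝ) * c = 1 := by exact_mod_cast h6
    have hc0 : (0 : ℝ) ≤ c := c.2
    have : (c : ℝ) = 1 := by nlinarith
    exact_mod_cast this
  rw [h1, h7, one_smul]

end Involutive

section Conj

variable {G : Type*} [Group G]

/-- The compatibility of `Ad(n)` with the coset relation of `T`, in the ★ `cosetCongr` shape. [folklore] -/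
private theorem conj_mem_iff' (T : Subgroup G) {n : G} (hn : ∀ g, n * g * n⁻¹ ∈ T ↔ g ∈ T) : ∀ g, (MulAut.conj n : G ≃* G) g ∈ T ↔ g ∈ T :=
  fun g => by rw [MulAut.conj_apply]; exact hn g

variable [TopologicalSpace G] [IsTopologicalGroup G]

/-- `Ad(n) = (n · ) ∘ ( · n⁻¹)` is continuous. [folklore] -/
private theorem continuous_conj' (n : G) : Continuous (MulAut.conj n : G ≃* G) := by
  have h : (fun g : G => n * g * n⁻¹) = (MulAut.conj n : G ≃* G) := funext fun g => (MulAut.conj_apply n g).symm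
  rw [← h]
  exact (continuous_const.mul continuous_id).mul continuous_const

/-- `Ad(n)⁻¹ = Ad(n⁻¹)` is continuous. [folklore] -/
private theorem continuous_conj_symm' (n : G) : Continuous (MulAut.conj n : G ≃* G).symm := by
  have h : (fun g : G => n⁻¹ * g * n) = ((MulAut.conj n : G ≃* G).symm : G → G) := funext fun g => (MulAut.conj_symm_apply n g).symm
  rw [← h]
  exact (continuous_const.mul continuous_id).mul continuous_const

end Conj

/-! ## §2 The realised Weyl group preserves the quotient measure and the quotient orbital integrals -/

section Normalizer

variable {G : Type*} [Group G] [TopologicalSpace G] [IsTopologicalGroup G] [LocallyCompactSpace G] [SecondCountableTopology G] [T2Space G]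
  [MeasurableSpace G] [BorelSpace G]
  (T : Subgroup G) (hT : IsClosed (T : Set G)) [MeasurableSpace (G ⧸ T)] [BorelSpace (G ⧸ T)]
  (t : Measure T) [t.IsHaarMeasure] [t.IsInvInvariant]
  (ν : Measure G) [ν.IsHaarMeasure] [ν.IsMulRightInvariant]
  {n : G} (hn : ∀ g, n * g * n⁻¹ ∈ T ↔ g ∈ T)

omit [T2Space G] [MeasurableSpace (G ⧸ T)] [BorelSpace (G ⧸ T)] [t.IsInvInvariant] in
/-- **`Ad(n)` ON `T` PRESERVES `t` WHEN `Ad(n)` IS INVOLUTIVE ON `T`** (e.g. `n² ∈ Z_G(T)`; the reflection `antidiag(1,1)` of the split Cartan of `U(1,1)`): the hypothesis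
`ht` of the invariance theorems below, in their exact spelling. [cite: Folland1995, §2.2] [cite: Shelstad1979, §4 p. 22] -/
theorem map_conj_eq_self_of_conj_conj_eq (hT : IsClosed (T : Set G)) (h2 : ∀ x : T, n * (n * (x : G) * n⁻¹) * n⁻¹ = x) :
    Measure.map (subgroupCongrHomeomorph (MulAut.conj n : G ≃* G) T T (conj_mem_iff' T hn) (continuous_conj' n) (continuous_conj_symm' n)) t = t := by
  haveI : LocallyCompactSpace T := hT.isClosedEmbedding_subtypeVal.locallyCompactSpace
  set ψ := subgroupCongrHomeomorph (MulAut.conj n : G ≃* G) T T (conj_mem_iff' T hn) (continuous_conj' n) (continuous_conj_symm' n) with hψ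
  -- `ψ` as a multiplicative equivalence of `T`
  have hmul : ∀ x y : T, ψ (x * y) = ψ x * ψ y := fun x y => by
    apply Subtype.ext
    simp only [hψ, coe_subgroupCongrHomeomorph_apply, Subgroup.coe_mul, map_mul]
  set ψm : T ≃* T := { ψ.toEquiv with map_mul' := hmul } with hψm
  have hcoe : (ψm : T → T) = ψ := rfl
  have hinv : ∀ x, ψm (ψm x) = x := fun x => by
    apply Subtype.ext
    show ((ψ (ψ x) : T) : G) = x
    simp only [hψ, coe_subgroupCongrHomeomorph_apply, MulAut.conj_apply]
    exact h2 x
  have h := map_eq_self_of_involutive ψm (by rw [hcoe]; exact ψ.continuous) (by exact ψ.symm.continuous) hinv t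
  rwa [hcoe] at h

/-- **THE RIGHT TRANSLATION BY A NORMALISER ELEMENT PRESERVES THE QUOTIENT MEASURE**: with `Ad(n)_* t = t`, the homeomorphism `y T ↦ n⁻¹ · Ad(n)(y) T = y n⁻¹ T` of
`G ⧸ T` carries `ν ∕ t` to itself (★ `map_cosetCongr_quotientMeasure` along `Ad(n)` — `Ad(n)_* ν = ν` — followed by ★ `map_smul_quotientMeasure`).
[cite: DeitmarEchterhoff2014, Thm. 1.5.3] [cite: Folland1995, §2.6 Thm. 2.49] [cite: Shelstad1979, §4 p. 22] -/
theorem map_conj_smul_quotientMeasure_eq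
    (ht : Measure.map (subgroupCongrHomeomorph (MulAut.conj n : G ≃* G) T T (conj_mem_iff' T hn) (continuous_conj' n) (continuous_conj_symm' n)) t = t) :
    Measure.map (fun q : G ⧸ T => n⁻¹ • cosetCongr (MulAut.conj n : G ≃* G) T T (conj_mem_iff' T hn) q) (quotientMeasure T t hT ν) = quotientMeasure T t hT ν := by
  haveI : IsClosed (T : Set G) := hT
  -- `Ad(n) = L_n ∘ R_{n⁻¹}` preserves the two-sided Haar measure `ν` (= ★ `Literature.NumberTheory.Automorphic.map_mulAutConj_eq_self`, inlined to keep this file generic)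
  have hν : Measure.map (MulAut.conj n : G ≃* G) ν = ν := by
    have h : ((MulAut.conj n : G ≃* G) : G → G) = (fun g => g * n⁻¹) ∘ (fun g => n * g) := by
      funext g; simp [MulAut.conj_apply, mul_assoc]
    rw [h, ← Measure.map_map (measurable_mul_const _) (measurable_const_mul _), map_mul_left_eq_self, map_mul_right_eq_self]
  have hcomp : (fun q : G ⧸ T => n⁻¹ • cosetCongr (MulAut.conj n : G ≃* G) T T (conj_mem_iff' T hn) q) =
      (fun q : G ⧸ T => n⁻¹ • q) ∘ cosetCongr (MulAut.conj n : G ≃* G) T T (conj_mem_iff' T hn) := rfl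
  rw [hcomp, ← Measure.map_map (measurable_const_smul _) (continuous_cosetCongr _ T T _ (continuous_conj' n)).measurable,
    map_cosetCongr_quotientMeasure (MulAut.conj n : G ≃* G) (continuous_conj' n) (continuous_conj_symm' n) T T (conj_mem_iff' T hn) t t ν ν ht.symm
      hν.symm,
    map_smul_quotientMeasure]

/-- **QUOTIENT ORBITAL INTEGRALS ARE INVARIANT UNDER THE NORMALISER**: for `n ∈ N_G(T)` with `Ad(n)_* t = t`, `γ` centralised by `T` and ANY `F : G → E`,
`∫_{G ⧸ T} F(y · n⁻¹ γ n · y⁻¹) d(ν ∕ t)(ȳ) = ∫_{G ⧸ T} F(y γ y⁻¹) d(ν ∕ t)(ȳ)` — the substitution `y ↦ y n⁻¹` is a homeomorphism of `G ⧸ T` preserving `ν ∕ t`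
(`map_conj_smul_quotientMeasure_eq`), so no measurability of `F` is needed.  Shelstad's «`Φ^T_f` is `Ω(G,T)`-invariant» for the realised Weyl group.
[cite: Shelstad1979, §4 pp. 22–23] [cite: DeitmarEchterhoff2014, Thm. 1.5.3] -/
theorem integral_descConj_conj_eq
    (ht : Measure.map (subgroupCongrHomeomorph (MulAut.conj n : G ≃* G) T T (conj_mem_iff' T hn) (continuous_conj' n) (continuous_conj_symm' n)) t = t)
    {γ : G} (hγ : ∀ g ∈ T, g * γ = γ * g) (hnγ : ∀ g ∈ T, g * (n⁻¹ * γ * n) = n⁻¹ * γ * n * g)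
    {E : Type*} [NormedAddCommGroup E] [NormedSpace ℝ E] (F : G → E) :
    ∫ y, descConj (n⁻¹ * γ * n) T hnγ F y ∂(quotientMeasure T t hT ν) = ∫ y, descConj γ T hγ F y ∂(quotientMeasure T t hT ν) := by
  haveI : IsClosed (T : Set G) := hT
  -- the substitution homeomorphism `Ψ : y T ↦ y n⁻¹ T`
  set Ψ : G ⧸ T ≃ₜ G ⧸ T :=
    (cosetCongrHomeomorph (MulAut.conj n : G ≃* G) T T (conj_mem_iff' T hn) (continuous_conj' n) (continuous_conj_symm' n)).trans (Homeomorph.smul n⁻¹) with hΨ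
  have hΨapply : ∀ q, Ψ q = n⁻¹ • cosetCongr (MulAut.conj n : G ≃* G) T T (conj_mem_iff' T hn) q := fun q => rfl
  have hΨmk : ∀ y : G, Ψ (QuotientGroup.mk y) = QuotientGroup.mk (y * n⁻¹) := fun y => by
    rw [hΨapply, cosetCongr_mk, MulAut.conj_apply, MulAction.Quotient.smul_mk, smul_eq_mul, ← mul_assoc, ← mul_assoc, inv_mul_cancel, one_mul]
  -- the integrand at `n⁻¹ γ n` is the integrand at `γ` composed with `Ψ`
  have hint : descConj (n⁻¹ * γ * n) T hnγ F = descConj γ T hγ F ∘ Ψ := by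
    funext q
    induction q using QuotientGroup.induction_on with
    | H y =>
      rw [Function.comp_apply, hΨmk, descConj_mk, descConj_mk]
      congr 1
      group
  have hmap : Measure.map Ψ (quotientMeasure T t hT ν) = quotientMeasure T t hT ν := by
    have : (Ψ : G ⧸ T → G ⧸ T) = fun q => n⁻¹ • cosetCongr (MulAut.conj n : G ≃* G) T T (conj_mem_iff' T hn) q := funext hΨapply
    rw [this]
    exact map_conj_smul_quotientMeasure_eq T hT t ν hn ht
  rw [hint]
  conv_rhs => rw [← hmap]
  rw [← Homeomorph.toMeasurableEquiv_coe, integral_map_equiv]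
  rfl

/-- **THE SAME FOR `n γ n⁻¹`** (apply the previous theorem to `n⁻¹`, whose conjugation is the inverse automorphism and preserves `t` as well).
[cite: Shelstad1979, §4 pp. 22–23] -/
theorem integral_descConj_conj_eq'
    (ht : Measure.map (subgroupCongrHomeomorph (MulAut.conj n : G ≃* G) T T (conj_mem_iff' T hn) (continuous_conj' n) (continuous_conj_symm' n)) t = t)
    {γ : G} (hγ : ∀ g ∈ T, g * γ = γ * g) (hnγ : ∀ g ∈ T, g * (n * γ * n⁻¹) = n * γ * n⁻¹ * g)
    {E : Type*} [NormedAddCommGroup E] [NormedSpace ℝ E] (F : G → E) :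
    ∫ y, descConj (n * γ * n⁻¹) T hnγ F y ∂(quotientMeasure T t hT ν) = ∫ y, descConj γ T hγ F y ∂(quotientMeasure T t hT ν) := by
  -- apply the previous theorem with `γ′ := n γ n⁻¹` and the same `n`: `n⁻¹ γ′ n = γ`
  have hγ' : ∀ g ∈ T, g * (n⁻¹ * (n * γ * n⁻¹) * n) = n⁻¹ * (n * γ * n⁻¹) * n * g := fun g hg => by
    have e : n⁻¹ * (n * γ * n⁻¹) * n = γ := by group
    rw [e]; exact hγ g hg
  have h := integral_descConj_conj_eq T hT t ν hn ht hnγ hγ' F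
  have e : descConj (n⁻¹ * (n * γ * n⁻¹) * n) T hγ' F = descConj γ T hγ F := by
    funext q
    induction q using QuotientGroup.induction_on with
    | H y => rw [descConj_mk, descConj_mk]; congr 1; group
  rw [e] at h
  exact h.symm

end Normalizer

end Literature.MeasureTheory.Group

end
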